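import Mathlib

/-!
# Parseval's identity for the quarter-wave (Dirichlet–Neumann) sine system on `[0,1]`

Topic `Literature/Analysis/Fourier`. The functions
`e_k(x) = √2 · sin((k + ½)πx)`, `k = 0, 1, 2, …`,
are the `L²(0,1)`-normalised eigenfunctions of the Sturm–Liouville problem `-u″ = νu`,
`u(0) = 0` (Dirichlet), `u′(1) = 0` (Neumann), with eigenvalues `ν_k = (k + ½)²π²`
("quarter-wave" or mixed sine system). They form a complete orthonormal system of `L²(0,1)`;
we prove the equivalent **Parseval identity**

* `hasSum_sq_qwCoeff` : for `f : ℝ → ℂ` measurable with `∫₀¹ ‖f‖² < ∞`,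
  `∑_{k ≥ 0} ‖c_k(f)‖² = ∫₀¹ ‖f(x)‖² dx`, `c_k(f) = qwCoeff f k = ∫₀¹ f(x) e_k(x) dx`
  (as a `HasSum` in `ℝ`; `tsum_sq_qwCoeff` is the `tsum` form);
* `hasSum_sq_qwCoeff_of_continuousOn` : the same for `f` merely continuous on `[0,1]`
  (no global hypothesis; reduced to the previous one through `IccExtend`).

Method (folklore): extend `f|[0,1]` to the cell `(-2,2]` oddly about `0` and evenly about `1`
(`qwExt f`); this is a period cell of `AddCircle 4`, and Mathlib's Parseval identity
`hasSum_sq_fourierCoeffOn` applies. The master formula `fourierCoeffOn_qwExt` expresses the `n`-th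
Fourier coefficient of the extension as `¼ ∫₀¹ K_n · f` with a symmetrised exponential kernel
`K_n`, which is `∓4i sin((k+½)πx)` at `n = ±(2k+1)` and vanishes identically at even `n`
(`qwKer_symm_odd/neg_odd/even`); so `|f̂(±(2k+1))|² = ‖c_k(f)‖²/2`, `f̂(2m) = 0`, while
`(1/4)∫_{-2}^{2} ‖qwExt f‖² = ∫₀¹ ‖f‖²`. The `ℤ`-indexed sum is re-indexed with
`HasSum.of_nat_of_neg_add_one` and `HasSum.even_add_odd`.

Also recorded: the elementary mode facts `e_k(0) = 0`, `cos((k+½)π) = 0` (i.e. `e_k′(1) = 0`),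
`e_k′ = √2(k+½)π cos((k+½)π·)`, `(e_k′)′ = -ν_k e_k` (`hasDerivAt_qwSin`,
`hasDerivAt_deriv_qwSin`).

Companions in the tree: `Literature/MathematicalPhysics/QuantumManyBody/NeumannBoxParseval.lean`
and `DirichletBoxParseval.lean` treat the pure Neumann cosine and pure Dirichlet sine systems
`cos(nπt/ℓ)`, `sin(nπt/ℓ)`; the mixed system here is not reducible to those by a reflection of
`[0,ℓ]` alone (it needs the period-`4` cell). Why formalised: it is the completeness input of the
diagonalisation of the Dirichlet–Neumann form
`‖φ″‖² - (5π²/2)‖φ′‖² + (9π⁴/16)‖φ‖² = ∑_k π⁴(k-1)k(k+1)(k+2)|c_k(φ)|²` used in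
`Literature/NumberTheory/LFunctions/Zhang2022/MainTermFormPSD.lean` (the positive-semidefiniteness
of the main-term form in the autopsy of Zhang's 2022 Landau–Siegel manuscript).

Sources: standard (any text on Fourier series / Sturm–Liouville expansions, e.g. the odd-even
reflection trick for mixed boundary conditions); tagged [folklore]. Design: hypotheses are global
measurability of `f` plus `IntervalIntegrable (‖f ·‖²) volume 0 1` (the values of `f` off `[0,1]`
enter `qwExt f` only outside the cell `(-2,2]` and never enter a coefficient); users with a
function given only on `[0,1]` use the `ContinuousOn` version or pre-compose with `Set.projIcc`.
NOT here: pointwise or uniform convergence of the expansion, and the form identity for derivatives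
(that is in the Zhang2022 companion file).
-/

noncomputable section

open MeasureTheory Set intervalIntegral
open scoped Real

namespace Literature.Analysis.Fourier

/-- The quarter-wave (Dirichlet–Neumann) sine mode `e_k(x) = √2 · sin((k + ½)πx)` (`k = 0,1,2,…`):
the `L²(0,1)`-normalised eigenfunctions of `-u″ = νu`, `u(0) = 0`, `u′(1) = 0`,
eigenvalues `ν_k = (k + ½)²π²`. [folklore] -/
def qwSin (k : ℕ) (x : ℝ) : ℝ := √2 * Real.sin (((k : ℝ) + 1 / 2) * π * x)

/-- The `k`-th quarter-wave sine coefficient of `f : ℝ → ℂ` on `[0,1]`,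
`c_k(f) = ∫₀¹ f(x) · √2 sin((k + ½)πx) dx`. [folklore] -/
def qwCoeff (f : ℝ → ℂ) (k : ℕ) : ℂ := ∫ x in (0:ℝ)..1, f x * (qwSin k x : ℂ)

/-- The odd-about-`0`, even-about-`1` extension of `f|[0,1]` to `(-2, 2]` (a period cell of
length `4`), used to reduce the quarter-wave system to the Fourier basis of `AddCircle 4`.
[folklore] -/
def qwExt (f : ℝ → ℂ) (x : ℝ) : ℂ :=
  if x ≤ -1 then -f (x + 2) else if x ≤ 0 then -f (-x) else if x ≤ 1 then f x else f (2 - x)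

variable {f : ℝ → ℂ}

/-- `qwExt f` is measurable when `f` is. [folklore] -/
theorem measurable_qwExt (hf : Measurable f) : Measurable (qwExt f) := by
  unfold qwExt
  refine Measurable.ite measurableSet_Iic ((hf.comp (measurable_id.add_const 2)).neg) ?_
  refine Measurable.ite measurableSet_Iic ((hf.comp measurable_neg).neg) ?_
  exact Measurable.ite measurableSet_Iic hf (hf.comp (measurable_const.sub measurable_id))

/-- On `(-2,-1)`: `qwExt f x = -f(x+2)`. [folklore] -/
theorem qwExt_eq_of_mem_Ioo₁ {x : ℝ} (hx : x ∈ Ioo (-2 : ℝ) (-1)) : qwExt f x = -f (x + 2) := by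
  simp only [qwExt, if_pos hx.2.le]

/-- On `(-1,0)`: `qwExt f x = -f(-x)`. [folklore] -/
theorem qwExt_eq_of_mem_Ioo₂ {x : ℝ} (hx : x ∈ Ioo (-1 : ℝ) 0) : qwExt f x = -f (-x) := by
  simp only [qwExt, if_neg (not_le.mpr hx.1), if_pos hx.2.le]

/-- On `(0,1)`: `qwExt f x = f x`. [folklore] -/
theorem qwExt_eq_of_mem_Ioo₃ {x : ℝ} (hx : x ∈ Ioo (0 : ℝ) 1) : qwExt f x = f x := by
  have h1 : ¬ x ≤ -1 := not_le.mpr (by linarith [hx.1])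
  simp only [qwExt, if_neg h1, if_neg (not_le.mpr hx.1), if_pos hx.2.le]

/-- On `(1,2)`: `qwExt f x = f(2-x)`. [folklore] -/
theorem qwExt_eq_of_mem_Ioo₄ {x : ℝ} (hx : x ∈ Ioo (1 : ℝ) 2) : qwExt f x = f (2 - x) := by
  have h1 : ¬ x ≤ -1 := not_le.mpr (by linarith [hx.1])
  have h2 : ¬ x ≤ 0 := not_le.mpr (by linarith [hx.1])
  simp only [qwExt, if_neg h1, if_neg h2, if_neg (not_le.mpr hx.1)]

/-- Interval integrability of the four pieces of `g · qwExt f`. [folklore] -/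
theorem intervalIntegrable_mul_qwExt_pieces (g : ℝ → ℂ) (hg : Continuous g)
    (hfi : IntervalIntegrable f volume 0 1) :
    IntervalIntegrable (fun x => g x * qwExt f x) volume (-2) (-1) ∧
    IntervalIntegrable (fun x => g x * qwExt f x) volume (-1) 0 ∧
    IntervalIntegrable (fun x => g x * qwExt f x) volume 0 1 ∧
    IntervalIntegrable (fun x => g x * qwExt f x) volume 1 2 := by
  refine ⟨?_, ?_, ?_, ?_⟩
  · have h' : IntervalIntegrable (fun x => f (x + 2)) volume (-2) (-1) := by
      convert hfi.comp_add_right 2 using 1 <;> norm_num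
    refine (h'.neg.continuousOn_mul hg.continuousOn).congr_uIoo ?_
    intro x hx
    rw [uIoo_of_le (by norm_num)] at hx
    simp only [qwExt_eq_of_mem_Ioo₁ hx, Pi.neg_apply]
  · have h' : IntervalIntegrable (fun x => f (-x)) volume (-1) 0 := by
      convert (hfi.comp_sub_left 0).symm using 1
      · funext x; simp
      · norm_num
      · norm_num
    refine (h'.neg.continuousOn_mul hg.continuousOn).congr_uIoo ?_
    intro x hx
    rw [uIoo_of_le (by norm_num)] at hx
    simp only [qwExt_eq_of_mem_Ioo₂ hx, Pi.neg_apply]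
  · refine (hfi.continuousOn_mul hg.continuousOn).congr_uIoo ?_
    intro x hx
    rw [uIoo_of_le (by norm_num)] at hx
    simp only [qwExt_eq_of_mem_Ioo₃ hx]
  · have h' : IntervalIntegrable (fun x => f (2 - x)) volume 1 2 := by
      convert (hfi.comp_sub_left 2).symm using 1 <;> norm_num
    refine (h'.continuousOn_mul hg.continuousOn).congr_uIoo ?_
    intro x hx
    rw [uIoo_of_le (by norm_num)] at hx
    simp only [qwExt_eq_of_mem_Ioo₄ hx]

/-- The four-piece evaluation of `∫_{-2}^{2} g · qwExt f` for a continuous weight `g`. [folklore] -/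
theorem integral_mul_qwExt (g : ℝ → ℂ) (hg : Continuous g)
    (hfi : IntervalIntegrable f volume 0 1) :
    ∫ x in (-2:ℝ)..2, g x * qwExt f x =
      ∫ x in (0:ℝ)..1, (g x - g (-x) - g (x - 2) + g (2 - x)) * f x := by
  obtain ⟨hp₁, hp₂, hp₃, hp₄⟩ := intervalIntegrable_mul_qwExt_pieces g hg hfi
  rw [← integral_add_adjacent_intervals hp₁ (hp₂.trans (hp₃.trans hp₄)),
    ← integral_add_adjacent_intervals hp₂ (hp₃.trans hp₄),
    ← integral_add_adjacent_intervals hp₃ hp₄]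
  -- evaluate each piece
  have e₁ : ∫ x in (-2:ℝ)..(-1), g x * qwExt f x = ∫ x in (0:ℝ)..1, -(g (x - 2) * f x) := by
    rw [integral_congr_Ioo_of_le (by norm_num : (-2:ℝ) ≤ -1)
      (g := fun x => (fun y => -(g (y - 2) * f y)) (x + 2)) ?_]
    · rw [intervalIntegral.integral_comp_add_right (fun y => -(g (y - 2) * f y))]
      norm_num
    · intro x hx
      simp only [qwExt_eq_of_mem_Ioo₁ hx, add_sub_cancel_right, mul_neg]
  have e₂ : ∫ x in (-1:ℝ)..0, g x * qwExt f x = ∫ x in (0:ℝ)..1, -(g (-x) * f x) := by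
    rw [integral_congr_Ioo_of_le (by norm_num : (-1:ℝ) ≤ 0)
      (g := fun x => (fun y => -(g (-y) * f y)) (-x)) ?_]
    · rw [intervalIntegral.integral_comp_neg (fun y => -(g (-y) * f y))]
      norm_num
    · intro x hx
      simp only [qwExt_eq_of_mem_Ioo₂ hx, neg_neg, mul_neg]
  have e₃ : ∫ x in (0:ℝ)..1, g x * qwExt f x = ∫ x in (0:ℝ)..1, g x * f x :=
    integral_congr_Ioo_of_le zero_le_one fun x hx => by simp only [qwExt_eq_of_mem_Ioo₃ hx]
  have e₄ : ∫ x in (1:ℝ)..2, g x * qwExt f x = ∫ x in (0:ℝ)..1, g (2 - x) * f x := by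
    rw [integral_congr_Ioo_of_le (by norm_num : (1:ℝ) ≤ 2)
      (g := fun x => (fun y => g (2 - y) * f y) (2 - x)) ?_]
    · rw [intervalIntegral.integral_comp_sub_left (fun y => g (2 - y) * f y)]
      norm_num
    · intro x hx
      simp only [qwExt_eq_of_mem_Ioo₄ hx, sub_sub_cancel]
  rw [e₁, e₂, e₃, e₄]
  have i₁ : IntervalIntegrable (fun x => g (x - 2) * f x) volume 0 1 :=
    hfi.continuousOn_mul (hg.comp (continuous_id.sub continuous_const)).continuousOn
  have i₂ : IntervalIntegrable (fun x => g (-x) * f x) volume 0 1 :=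
    hfi.continuousOn_mul (hg.comp continuous_neg).continuousOn
  have i₃ : IntervalIntegrable (fun x => g x * f x) volume 0 1 := hfi.continuousOn_mul hg.continuousOn
  have i₄ : IntervalIntegrable (fun x => g (2 - x) * f x) volume 0 1 :=
    hfi.continuousOn_mul (hg.comp (continuous_const.sub continuous_id)).continuousOn
  have hR : ∫ x in (0:ℝ)..1, (g x - g (-x) - g (x - 2) + g (2 - x)) * f x =
      (((∫ x in (0:ℝ)..1, g x * f x) - ∫ x in (0:ℝ)..1, g (-x) * f x)
        - ∫ x in (0:ℝ)..1, g (x - 2) * f x) + ∫ x in (0:ℝ)..1, g (2 - x) * f x := by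
    rw [← intervalIntegral.integral_sub i₃ i₂, ← intervalIntegral.integral_sub (i₃.sub i₂) i₁,
      ← intervalIntegral.integral_add ((i₃.sub i₂).sub i₁) i₄]
    refine intervalIntegral.integral_congr fun x _ => ?_
    ring
  rw [hR, intervalIntegral.integral_neg, intervalIntegral.integral_neg]
  ring


/-- Interval integrability of the four pieces of `‖qwExt f‖²`. [folklore] -/
theorem intervalIntegrable_normSq_qwExt_pieces
    (hf2 : IntervalIntegrable (fun x => ‖f x‖ ^ 2) volume 0 1) :
    IntervalIntegrable (fun x => ‖qwExt f x‖ ^ 2) volume (-2) (-1) ∧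
    IntervalIntegrable (fun x => ‖qwExt f x‖ ^ 2) volume (-1) 0 ∧
    IntervalIntegrable (fun x => ‖qwExt f x‖ ^ 2) volume 0 1 ∧
    IntervalIntegrable (fun x => ‖qwExt f x‖ ^ 2) volume 1 2 := by
  refine ⟨?_, ?_, ?_, ?_⟩
  · have h' : IntervalIntegrable (fun x => ‖f (x + 2)‖ ^ 2) volume (-2) (-1) := by
      convert hf2.comp_add_right 2 using 1 <;> norm_num
    refine h'.congr_uIoo ?_
    intro x hx
    rw [uIoo_of_le (by norm_num)] at hx
    simp only [qwExt_eq_of_mem_Ioo₁ hx, norm_neg]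
  · have h' : IntervalIntegrable (fun x => ‖f (-x)‖ ^ 2) volume (-1) 0 := by
      convert (hf2.comp_sub_left 0).symm using 1
      · funext x; simp
      · norm_num
      · norm_num
    refine h'.congr_uIoo ?_
    intro x hx
    rw [uIoo_of_le (by norm_num)] at hx
    simp only [qwExt_eq_of_mem_Ioo₂ hx, norm_neg]
  · refine hf2.congr_uIoo ?_
    intro x hx
    rw [uIoo_of_le (by norm_num)] at hx
    simp only [qwExt_eq_of_mem_Ioo₃ hx]
  · have h' : IntervalIntegrable (fun x => ‖f (2 - x)‖ ^ 2) volume 1 2 := by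
      convert (hf2.comp_sub_left 2).symm using 1 <;> norm_num
    refine h'.congr_uIoo ?_
    intro x hx
    rw [uIoo_of_le (by norm_num)] at hx
    simp only [qwExt_eq_of_mem_Ioo₄ hx]

/-- `‖qwExt f‖²` is interval integrable on `[-2, 2]`. [folklore] -/
theorem intervalIntegrable_normSq_qwExt
    (hf2 : IntervalIntegrable (fun x => ‖f x‖ ^ 2) volume 0 1) :
    IntervalIntegrable (fun x => ‖qwExt f x‖ ^ 2) volume (-2) 2 := by
  obtain ⟨hp₁, hp₂, hp₃, hp₄⟩ := intervalIntegrable_normSq_qwExt_pieces (f := f) hf2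
  exact hp₁.trans (hp₂.trans (hp₃.trans hp₄))

/-- `∫_{-2}^{2} ‖qwExt f‖² = 4 ∫₀¹ ‖f‖²`. [folklore] -/
theorem integral_normSq_qwExt (hf2 : IntervalIntegrable (fun x => ‖f x‖ ^ 2) volume 0 1) :
    ∫ x in (-2:ℝ)..2, ‖qwExt f x‖ ^ 2 = 4 * ∫ x in (0:ℝ)..1, ‖f x‖ ^ 2 := by
  obtain ⟨hp₁, hp₂, hp₃, hp₄⟩ := intervalIntegrable_normSq_qwExt_pieces (f := f) hf2
  rw [← integral_add_adjacent_intervals hp₁ (hp₂.trans (hp₃.trans hp₄)),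
    ← integral_add_adjacent_intervals hp₂ (hp₃.trans hp₄),
    ← integral_add_adjacent_intervals hp₃ hp₄]
  have e₁ : ∫ x in (-2:ℝ)..(-1), ‖qwExt f x‖ ^ 2 = ∫ x in (0:ℝ)..1, ‖f x‖ ^ 2 := by
    rw [integral_congr_Ioo_of_le (by norm_num : (-2:ℝ) ≤ -1)
      (g := fun x => (fun y => ‖f y‖ ^ 2) (x + 2)) ?_]
    · rw [intervalIntegral.integral_comp_add_right (fun y => ‖f y‖ ^ 2)]
      norm_num
    · intro x hx
      simp only [qwExt_eq_of_mem_Ioo₁ hx, norm_neg]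
  have e₂ : ∫ x in (-1:ℝ)..0, ‖qwExt f x‖ ^ 2 = ∫ x in (0:ℝ)..1, ‖f x‖ ^ 2 := by
    rw [integral_congr_Ioo_of_le (by norm_num : (-1:ℝ) ≤ 0)
      (g := fun x => (fun y => ‖f y‖ ^ 2) (-x)) ?_]
    · rw [intervalIntegral.integral_comp_neg (fun y => ‖f y‖ ^ 2)]
      norm_num
    · intro x hx
      simp only [qwExt_eq_of_mem_Ioo₂ hx, norm_neg]
  have e₃ : ∫ x in (0:ℝ)..1, ‖qwExt f x‖ ^ 2 = ∫ x in (0:ℝ)..1, ‖f x‖ ^ 2 :=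
    integral_congr_Ioo_of_le zero_le_one fun x hx => by simp only [qwExt_eq_of_mem_Ioo₃ hx]
  have e₄ : ∫ x in (1:ℝ)..2, ‖qwExt f x‖ ^ 2 = ∫ x in (0:ℝ)..1, ‖f x‖ ^ 2 := by
    rw [integral_congr_Ioo_of_le (by norm_num : (1:ℝ) ≤ 2)
      (g := fun x => (fun y => ‖f y‖ ^ 2) (2 - x)) ?_]
    · rw [intervalIntegral.integral_comp_sub_left (fun y => ‖f y‖ ^ 2)]
      norm_num
    · intro x hx
      simp only [qwExt_eq_of_mem_Ioo₄ hx]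
  rw [e₁, e₂, e₃, e₄]
  ring

/-- `qwExt f` is square integrable on the period cell `(-2, 2]`. [folklore] -/
theorem memLp_two_qwExt (hf : Measurable f)
    (hf2 : IntervalIntegrable (fun x => ‖f x‖ ^ 2) volume 0 1) :
    MemLp (qwExt f) 2 (volume.restrict (Ioc (-2 : ℝ) 2)) := by
  rw [memLp_two_iff_integrable_sq_norm (measurable_qwExt hf).aestronglyMeasurable]
  have h := intervalIntegrable_normSq_qwExt (f := f) hf2
  rw [intervalIntegrable_iff_integrableOn_Ioc_of_le (by norm_num)] at h
  exact h


/-! ### Fourier coefficients of the extension on the cell `(-2, 2]` -/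

/-- `-2 < 2`, the endpoints of the period cell (named for use in `fourierCoeffOn`). [folklore] -/
theorem neg_two_lt_two : (-2 : ℝ) < 2 := by norm_num

/-- The exponential weight `x ↦ e^{-iπ n x/2}` of the `n`-th Fourier coefficient on `(-2,2]`. [folklore] -/
def qwKer (n : ℤ) (x : ℝ) : ℂ := Complex.exp (-((π : ℂ) * Complex.I * n * x / 2))

/-- The kernel `qwKer n` is continuous. [folklore] -/
theorem continuous_qwKer (n : ℤ) : Continuous (qwKer n) := by
  unfold qwKer
  fun_prop

/-- Mathlib's character `fourier (-n)` on `AddCircle (2 - -2)` evaluated at `↑x` is `qwKer n x`. [folklore] -/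
theorem fourier_neg_coe_eq_qwKer (n : ℤ) (x : ℝ) :
    fourier (-n) ((x : ℝ) : AddCircle ((2:ℝ) - -2)) = qwKer n x := by
  rw [fourier_coe_apply, qwKer]
  congr 1
  push_cast
  ring

/-- Master formula: the `n`-th Fourier coefficient of `qwExt f` on `(-2,2]` as an integral over
`[0,1]` against the symmetrised kernel. [folklore] -/
theorem fourierCoeffOn_qwExt (hfi : IntervalIntegrable f volume 0 1) (n : ℤ) :
    fourierCoeffOn neg_two_lt_two (qwExt f) n =
      (1 / 4 : ℂ) * ∫ x in (0:ℝ)..1,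
        (qwKer n x - qwKer n (-x) - qwKer n (x - 2) + qwKer n (2 - x)) * f x := by
  rw [fourierCoeffOn_eq_integral]
  simp_rw [fourier_neg_coe_eq_qwKer, smul_eq_mul]
  rw [integral_mul_qwExt (qwKer n) (continuous_qwKer n) hfi]
  norm_num

/-- Pointwise evaluation of the symmetrised kernel at an odd frequency `n = 2k+1`:
`K_{2k+1}(x) = -4i sin((k+½)πx)`. [folklore] -/
theorem qwKer_symm_odd (k : ℕ) (x : ℝ) :
    qwKer (2 * k + 1) x - qwKer (2 * k + 1) (-x) - qwKer (2 * k + 1) (x - 2)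
      + qwKer (2 * k + 1) (2 - x) =
      -4 * Complex.I * Complex.sin ((((k : ℝ) + 1 / 2) * π * x : ℝ) : ℂ) := by
  set θ : ℂ := ((((k : ℝ) + 1 / 2) * π * x : ℝ) : ℂ) with hθ
  have h1 : qwKer (2 * k + 1) x = Complex.exp (-θ * Complex.I) := by
    rw [qwKer, hθ]; congr 1; push_cast; ring
  have h2 : qwKer (2 * k + 1) (-x) = Complex.exp (θ * Complex.I) := by
    rw [qwKer, hθ]; congr 1; push_cast; ring
  have h3 : qwKer (2 * k + 1) (x - 2) = -Complex.exp (-θ * Complex.I) := by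
    rw [qwKer, hθ]
    rw [show -((π : ℂ) * Complex.I * ((2 * k + 1 : ℤ) : ℂ) * ((x - 2 : ℝ) : ℂ) / 2) =
      -((((k : ℝ) + 1 / 2) * π * x : ℝ) : ℂ) * Complex.I + ((k : ℕ) * (2 * π * Complex.I)
        + π * Complex.I) by push_cast; ring]
    rw [Complex.exp_add, Complex.exp_add, Complex.exp_nat_mul_two_pi_mul_I, Complex.exp_pi_mul_I]
    ring
  have h4 : qwKer (2 * k + 1) (2 - x) = -Complex.exp (θ * Complex.I) := by
    rw [qwKer, hθ]
    rw [show -((π : ℂ) * Complex.I * ((2 * k + 1 : ℤ) : ℂ) * ((2 - x : ℝ) : ℂ) / 2) =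
      ((((k : ℝ) + 1 / 2) * π * x : ℝ) : ℂ) * Complex.I - ((k : ℕ) * (2 * π * Complex.I)
        + π * Complex.I) by push_cast; ring]
    rw [Complex.exp_sub, Complex.exp_add, Complex.exp_nat_mul_two_pi_mul_I, Complex.exp_pi_mul_I]
    ring
  rw [h1, h2, h3, h4, Complex.sin]
  linear_combination (2 * (Complex.exp (-θ * Complex.I) - Complex.exp (θ * Complex.I))) *
    Complex.I_sq

/-- Pointwise evaluation of the symmetrised kernel at `-(2k+1)`: `K_{-(2k+1)}(x) = 4i sin((k+½)πx)`. [folklore] -/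
theorem qwKer_symm_neg_odd (k : ℕ) (x : ℝ) :
    qwKer (-(2 * k + 1)) x - qwKer (-(2 * k + 1)) (-x) - qwKer (-(2 * k + 1)) (x - 2)
      + qwKer (-(2 * k + 1)) (2 - x) =
      4 * Complex.I * Complex.sin ((((k : ℝ) + 1 / 2) * π * x : ℝ) : ℂ) := by
  have e : ∀ y : ℝ, qwKer (-(2 * k + 1)) y = qwKer (2 * k + 1) (-y) := by
    intro y; rw [qwKer, qwKer]; congr 1; push_cast; ring
  simp only [e, neg_neg]
  have := qwKer_symm_odd k x
  rw [show -(x - 2) = 2 - x by ring, show -(2 - x) = x - 2 by ring]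
  linear_combination (-1 : ℂ) * this

/-- The symmetrised kernel vanishes identically at even frequencies. [folklore] -/
theorem qwKer_symm_even (m : ℤ) (x : ℝ) :
    qwKer (2 * m) x - qwKer (2 * m) (-x) - qwKer (2 * m) (x - 2) + qwKer (2 * m) (2 - x) = 0 := by
  have h3 : qwKer (2 * m) (x - 2) = qwKer (2 * m) x := by
    rw [qwKer, qwKer]
    rw [show -((π : ℂ) * Complex.I * ((2 * m : ℤ) : ℂ) * ((x - 2 : ℝ) : ℂ) / 2) =
      -((π : ℂ) * Complex.I * ((2 * m : ℤ) : ℂ) * (x : ℂ) / 2) + m * (2 * π * Complex.I)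
        by push_cast; ring]
    rw [Complex.exp_add, Complex.exp_int_mul_two_pi_mul_I, mul_one]
  have h4 : qwKer (2 * m) (2 - x) = qwKer (2 * m) (-x) := by
    rw [qwKer, qwKer]
    rw [show -((π : ℂ) * Complex.I * ((2 * m : ℤ) : ℂ) * ((2 - x : ℝ) : ℂ) / 2) =
      -((π : ℂ) * Complex.I * ((2 * m : ℤ) : ℂ) * ((-x : ℝ) : ℂ) / 2) + ((-m : ℤ) : ℂ) * (2 * π * Complex.I)
        by push_cast; ring]
    rw [Complex.exp_add, Complex.exp_int_mul_two_pi_mul_I, mul_one]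
  rw [h3, h4]; ring


/-- The auxiliary integral `J_k(f) = ∫₀¹ sin((k+½)πx) f(x) dx`. [folklore] -/
def qwJ (f : ℝ → ℂ) (k : ℕ) : ℂ :=
  ∫ x in (0:ℝ)..1, Complex.sin ((((k : ℝ) + 1 / 2) * π * x : ℝ) : ℂ) * f x

/-- `c_k(f) = √2 · J_k(f)`. [folklore] -/
theorem qwCoeff_eq_sqrt_two_mul_qwJ (k : ℕ) : qwCoeff f k = (√2 : ℂ) * qwJ f k := by
  rw [qwCoeff, qwJ, ← intervalIntegral.integral_const_mul]
  refine intervalIntegral.integral_congr fun x _ => ?_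
  simp only [qwSin]
  push_cast
  ring

/-- `f̂(2k+1) = -i J_k(f)` for the extension `qwExt f` on `(-2,2]`. [folklore] -/
theorem fourierCoeffOn_qwExt_odd (hfi : IntervalIntegrable f volume 0 1) (k : ℕ) :
    fourierCoeffOn neg_two_lt_two (qwExt f) (2 * k + 1) = -Complex.I * qwJ f k := by
  rw [fourierCoeffOn_qwExt hfi, qwJ, ← intervalIntegral.integral_const_mul,
    ← intervalIntegral.integral_const_mul]
  refine intervalIntegral.integral_congr fun x _ => ?_
  simp only [qwKer_symm_odd k x]
  ring

/-- `f̂(-(2k+1)) = i J_k(f)` for the extension `qwExt f` on `(-2,2]`. [folklore] -/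
theorem fourierCoeffOn_qwExt_neg_odd (hfi : IntervalIntegrable f volume 0 1) (k : ℕ) :
    fourierCoeffOn neg_two_lt_two (qwExt f) (-(2 * k + 1)) = Complex.I * qwJ f k := by
  rw [fourierCoeffOn_qwExt hfi, qwJ, ← intervalIntegral.integral_const_mul,
    ← intervalIntegral.integral_const_mul]
  refine intervalIntegral.integral_congr fun x _ => ?_
  simp only [qwKer_symm_neg_odd k x]
  ring

/-- `f̂(2m) = 0` for the extension `qwExt f` on `(-2,2]`. [folklore] -/
theorem fourierCoeffOn_qwExt_even (hfi : IntervalIntegrable f volume 0 1) (m : ℤ) :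
    fourierCoeffOn neg_two_lt_two (qwExt f) (2 * m) = 0 := by
  rw [fourierCoeffOn_qwExt hfi]
  simp only [qwKer_symm_even m, zero_mul, intervalIntegral.integral_zero, mul_zero]

/-- `|f̂(2k+1)|² = ‖c_k(f)‖²/2`. [folklore] -/
theorem norm_sq_fourierCoeffOn_qwExt_odd (hfi : IntervalIntegrable f volume 0 1) (k : ℕ) :
    ‖fourierCoeffOn neg_two_lt_two (qwExt f) (2 * k + 1)‖ ^ 2 = ‖qwCoeff f k‖ ^ 2 / 2 := by
  rw [fourierCoeffOn_qwExt_odd hfi, qwCoeff_eq_sqrt_two_mul_qwJ, norm_mul, norm_mul, norm_neg,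
    Complex.norm_I, one_mul, Complex.norm_real, Real.norm_of_nonneg (Real.sqrt_nonneg _), mul_pow,
    Real.sq_sqrt (by norm_num : (0:ℝ) ≤ 2)]
  ring

/-- `|f̂(-(2k+1))|² = ‖c_k(f)‖²/2`. [folklore] -/
theorem norm_sq_fourierCoeffOn_qwExt_neg_odd (hfi : IntervalIntegrable f volume 0 1) (k : ℕ) :
    ‖fourierCoeffOn neg_two_lt_two (qwExt f) (-(2 * k + 1))‖ ^ 2 = ‖qwCoeff f k‖ ^ 2 / 2 := by
  rw [fourierCoeffOn_qwExt_neg_odd hfi, qwCoeff_eq_sqrt_two_mul_qwJ, norm_mul, norm_mul,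
    Complex.norm_I, one_mul, Complex.norm_real, Real.norm_of_nonneg (Real.sqrt_nonneg _), mul_pow,
    Real.sq_sqrt (by norm_num : (0:ℝ) ≤ 2)]
  ring

/-- From measurability and `∫₀¹ ‖f‖² < ∞`: `f ∈ L²` of `(0,1]` in the `MemLp` sense. [folklore] -/
theorem memLp_two_of_sq (hf : Measurable f)
    (hf2 : IntervalIntegrable (fun x => ‖f x‖ ^ 2) volume 0 1) :
    MemLp f 2 (volume.restrict (Ioc (0:ℝ) 1)) := by
  rw [memLp_two_iff_integrable_sq_norm hf.aestronglyMeasurable]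
  rwa [intervalIntegrable_iff_integrableOn_Ioc_of_le zero_le_one] at hf2

/-- A measurable `f` with `∫₀¹ ‖f‖² < ∞` is integrable on `[0,1]`. [folklore] -/
theorem intervalIntegrable_of_sq (hf : Measurable f)
    (hf2 : IntervalIntegrable (fun x => ‖f x‖ ^ 2) volume 0 1) :
    IntervalIntegrable f volume 0 1 := by
  rw [intervalIntegrable_iff_integrableOn_Ioc_of_le zero_le_one]
  exact (memLp_two_of_sq hf hf2).integrable one_le_two

/-- **Parseval's identity for the quarter-wave sine system.** For a measurable `f : ℝ → ℂ`
with `∫₀¹ ‖f‖² < ∞`, the squared moduli of the coefficients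
`c_k(f) = ∫₀¹ f(x)√2 sin((k+½)πx) dx` sum to `∫₀¹ ‖f(x)‖² dx`; equivalently,
`{√2 sin((k+½)πx)}_{k ≥ 0}` is a complete orthonormal system of `L²(0,1)` (the eigenfunctions of
the Sturm–Liouville problem `-u″ = νu`, `u(0) = 0 = u′(1)`). Proof: odd/even extension to the
cell `(-2,2]` and Mathlib's Parseval identity `hasSum_sq_fourierCoeffOn` on `AddCircle 4`, whose
coefficients at `±(2k+1)` are `∓ i c_k/√2` and vanish at even frequencies. [folklore] -/
theorem hasSum_sq_qwCoeff (hf : Measurable f)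
    (hf2 : IntervalIntegrable (fun x => ‖f x‖ ^ 2) volume 0 1) :
    HasSum (fun k : ℕ => ‖qwCoeff f k‖ ^ 2) (∫ x in (0:ℝ)..1, ‖f x‖ ^ 2) := by
  have hfi := intervalIntegrable_of_sq hf hf2
  set F : ℤ → ℝ := fun n => ‖fourierCoeffOn neg_two_lt_two (qwExt f) n‖ ^ 2 with hF
  have hP : HasSum F (∫ x in (0:ℝ)..1, ‖f x‖ ^ 2) := by
    have h := hasSum_sq_fourierCoeffOn neg_two_lt_two (memLp_two_qwExt hf hf2)
    rw [integral_normSq_qwExt hf2, smul_eq_mul,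
      show ((2:ℝ) - -2)⁻¹ * (4 * ∫ x in (0:ℝ)..1, ‖f x‖ ^ 2) = ∫ x in (0:ℝ)..1, ‖f x‖ ^ 2 by
        ring] at h
    exact h
  set c : ℕ → ℝ := fun k => ‖qwCoeff f k‖ ^ 2 with hc
  have hs₁ : Summable (fun n : ℕ => F n) := hP.summable.comp_injective Nat.cast_injective
  -- values of the two half-sequences
  have ho₁ : ∀ k : ℕ, F ((2 * k + 1 : ℕ) : ℤ) = c k / 2 := fun k => by
    simp only [hF, hc]; push_cast; exact norm_sq_fourierCoeffOn_qwExt_odd hfi k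
  have he₁ : ∀ k : ℕ, F ((2 * k : ℕ) : ℤ) = 0 := fun k => by
    simp only [hF]; push_cast
    rw [fourierCoeffOn_qwExt_even hfi (k : ℤ)]; simp
  have he₂ : ∀ k : ℕ, F (-(((2 * k : ℕ) : ℤ) + 1)) = c k / 2 := fun k => by
    simp only [hF, hc]; push_cast; exact norm_sq_fourierCoeffOn_qwExt_neg_odd hfi k
  have ho₂ : ∀ k : ℕ, F (-(((2 * k + 1 : ℕ) : ℤ) + 1)) = 0 := fun k => by
    simp only [hF]
    rw [show (-(((2 * k + 1 : ℕ) : ℤ) + 1) : ℤ) = 2 * (-(k + 1 : ℤ)) by push_cast; ring,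
      fourierCoeffOn_qwExt_even hfi]
    simp
  -- summability of `c`
  have hsc : Summable c := by
    have h := (hs₁.comp_injective (f := fun n : ℕ => F n)
      (show Function.Injective (fun k : ℕ => 2 * k + 1) from
        fun a b hab => by simpa using hab)).mul_left 2
    refine h.congr fun k => ?_
    simp only [Function.comp_apply, ho₁]
    ring
  set S := ∑' k, c k with hS
  have hcS : HasSum c S := hsc.hasSum
  have h₁ : HasSum (fun n : ℕ => F n) (0 + S / 2) := by
    refine HasSum.even_add_odd ?_ ?_
    · simp_rw [he₁]; exact hasSum_zero
    · simp_rw [ho₁]; exact hcS.div_const 2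
  have h₂ : HasSum (fun n : ℕ => F (-(n + 1))) (S / 2 + 0) := by
    refine HasSum.even_add_odd ?_ ?_
    · simp_rw [he₂]; exact hcS.div_const 2
    · simp_rw [ho₂]; exact hasSum_zero
  have h := HasSum.of_nat_of_neg_add_one h₁ h₂
  have huniq := hP.unique h
  have : S = ∫ x in (0:ℝ)..1, ‖f x‖ ^ 2 := by linarith
  rwa [this] at hcS

/-- Parseval as an equation: `∑' k, ‖c_k(f)‖² = ∫₀¹ ‖f‖²`. [folklore] -/
theorem tsum_sq_qwCoeff (hf : Measurable f)
    (hf2 : IntervalIntegrable (fun x => ‖f x‖ ^ 2) volume 0 1) :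
    ∑' k : ℕ, ‖qwCoeff f k‖ ^ 2 = ∫ x in (0:ℝ)..1, ‖f x‖ ^ 2 :=
  (hasSum_sq_qwCoeff hf hf2).tsum_eq


/-! ### Elementary properties of the modes -/

/-- The frequency `(k + ½)π` of the `k`-th mode. [folklore] -/
def qwFreq (k : ℕ) : ℝ := ((k : ℝ) + 1 / 2) * π

/-- `(k+½)π > 0`. [folklore] -/
theorem qwFreq_pos (k : ℕ) : 0 < qwFreq k := by
  unfold qwFreq; positivity

/-- `e_k(x) = √2 sin((k+½)π x)` in terms of `qwFreq`. [folklore] -/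
theorem qwSin_eq (k : ℕ) (x : ℝ) : qwSin k x = √2 * Real.sin (qwFreq k * x) := rfl

/-- Dirichlet condition at `0`: `e_k(0) = 0`. [folklore] -/
theorem qwSin_zero (k : ℕ) : qwSin k 0 = 0 := by simp [qwSin]

/-- `cos((k+½)π) = 0`, i.e. the Neumann condition `e_k′(1) = 0`. [folklore] -/
theorem cos_qwFreq (k : ℕ) : Real.cos (qwFreq k) = 0 := by
  rw [Real.cos_eq_zero_iff]
  exact ⟨k, by rw [qwFreq]; push_cast; ring⟩

/-- `e_k′ = √2 (k+½)π cos((k+½)π ·)`. [folklore] -/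
theorem hasDerivAt_qwSin (k : ℕ) (x : ℝ) :
    HasDerivAt (qwSin k) (√2 * (qwFreq k * Real.cos (qwFreq k * x))) x := by
  have h : HasDerivAt (fun y => qwFreq k * y) (qwFreq k) x := by
    simpa using (hasDerivAt_id x).const_mul (qwFreq k)
  have h2 : HasDerivAt (fun y => √2 * Real.sin (qwFreq k * y))
      (√2 * (Real.cos (qwFreq k * x) * qwFreq k)) x :=
    ((Real.hasDerivAt_sin _).comp x h).const_mul √2
  have e : qwSin k = fun y => √2 * Real.sin (qwFreq k * y) := rfl
  rw [e]
  exact h2.congr_deriv (by ring)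

/-- `(e_k′)′ = -(k+½)²π² e_k`: the modes are eigenfunctions of `-d²/dx²`. [folklore] -/
theorem hasDerivAt_deriv_qwSin (k : ℕ) (x : ℝ) :
    HasDerivAt (fun y => √2 * (qwFreq k * Real.cos (qwFreq k * y)))
      (-(qwFreq k ^ 2) * qwSin k x) x := by
  have h : HasDerivAt (fun y => qwFreq k * y) (qwFreq k) x := by
    simpa using (hasDerivAt_id x).const_mul (qwFreq k)
  have h2 : HasDerivAt (fun y => √2 * (qwFreq k * Real.cos (qwFreq k * y)))
      (√2 * (qwFreq k * (-Real.sin (qwFreq k * x) * qwFreq k))) x :=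
    (((Real.hasDerivAt_cos _).comp x h).const_mul (qwFreq k)).const_mul √2
  refine h2.congr_deriv ?_
  rw [qwSin_eq]
  ring

/-! ### Parseval for functions continuous on `[0,1]` -/

/-- The coefficients only see `f` on `[0,1]`: if `f = g` on `[0,1]` then `c_k(f) = c_k(g)`. [folklore] -/
theorem qwCoeff_congr {g : ℝ → ℂ} (h : EqOn f g (Icc 0 1)) (k : ℕ) : qwCoeff f k = qwCoeff g k := by
  unfold qwCoeff
  refine intervalIntegral.integral_congr fun x hx => ?_
  rw [uIcc_of_le zero_le_one] at hx
  simp only [h hx]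

/-- **Parseval for the quarter-wave sine system, continuous version.** For `f` continuous on
`[0,1]`, `∑_k ‖c_k(f)‖² = ∫₀¹ ‖f‖²` (as a `HasSum`). Reduced to `hasSum_sq_qwCoeff` by replacing
`f` with its continuous extension `IccExtend` (constant outside `[0,1]`), which changes neither
side. [folklore] -/
theorem hasSum_sq_qwCoeff_of_continuousOn (hf : ContinuousOn f (Icc 0 1)) :
    HasSum (fun k : ℕ => ‖qwCoeff f k‖ ^ 2) (∫ x in (0:ℝ)..1, ‖f x‖ ^ 2) := by
  set g : ℝ → ℂ := IccExtend zero_le_one ((Icc (0:ℝ) 1).restrict f) with hg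
  have hgc : Continuous g := hf.restrict.Icc_extend'
  have hfg : EqOn f g (Icc 0 1) := fun x hx => by
    simp only [hg, IccExtend_of_mem _ _ hx, restrict_apply]
  have h := hasSum_sq_qwCoeff hgc.measurable
    ((hgc.norm.pow 2).intervalIntegrable (μ := volume) 0 1)
  have h1 : (fun k : ℕ => ‖qwCoeff g k‖ ^ 2) = fun k => ‖qwCoeff f k‖ ^ 2 := by
    funext k; rw [qwCoeff_congr hfg]
  have h2 : ∫ x in (0:ℝ)..1, ‖g x‖ ^ 2 = ∫ x in (0:ℝ)..1, ‖f x‖ ^ 2 := by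
    refine intervalIntegral.integral_congr fun x hx => ?_
    rw [uIcc_of_le zero_le_one] at hx
    simp only [hfg hx]
  rwa [h1, h2] at h

end Literature.Analysis.Fourier
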